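import Summits.ABC.IUTFork.Cor312SharpNotBInput
import Summits.ABC.IUTFork.Cor312PilotIdelesDH
import HarnessLib

/-!
# [IUTchIII] Cor. 3.12 — the per-packet B-INPUT at the SHARP real setting reduces to one idele-norm inequality (TEAM B §2)

Record-only file (D-0012) of the abc-iut cell (Cor. 3.12 STRATEGY TEAM B «estimate / log-Kummer»,
HUMAN RULING D-0067 (3), seat abc-iut-c312-11 = B1; §2 of the DH-sharp composition — c312-3 g4's
volume formulas (`Cor312PilotIdelesDH` p419746 / `Cor312ThetaBoxesDH` p419385, consumed BY NAME and
credited) composed through the §1 wiring (`Cor312SharpNotBInput`, p418741), per A2's 03:02:54Z lane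
courtesy and the c312-3 first-refusal window of C312-TEAMS.md 02:48:33Z/03:40:09Z); TAKES NO SIDE. At the assembled real
setting with the SHARP Dupuy–Hilado pilot regions (`Real.settingDHVolSharp` — Θ-boxes
`ι_j(t_{Θ,j})·(R_I)^∼` from Θ-pilot ideles `t`, `q`-centre from `q`-pilot ideles `tq`), the
per-packet B-INPUT of GAP row G-c312-11-1 REDUCES TO NUMBERS:

* `logvol_thetaRegion_settingDHVolSharp_inr` — every single Kummer image (the boxes are constant in
  the lattice position `m` — the sharp reading of the (Ind3)-collapse) has the log-volume
  `Σ_{v⃗} w·log‖t_{Θ,i+1,v_{i+1}}‖` at a prime;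
* `not_volumeTransport_settingDHVolSharp_of_lt` / `not_volumeTransportAt_…` — if at ONE label and
  ONE prime the Θ-idele sum is strictly below the `q`-idele sum, layer 1's `VolumeTransport` (and
  every uniform `VolumeTransportAt m₀`) FAILS at the sharp real setting;
* `not_qFrobComparison_settingDHVolSharp_of_lt` / `not_qFrobEqualityAt_…` — under the typed
  Thm. 3.11 (ii) (a) of ANY column for the real line data (the abstract-column binder shape of
  `Cor312TeamAHonestCensusRealDH`), the SAME inequality refutes the layer-2 decls the GAP row
  nominates, at every lattice position (the `ThetaRegionsAdm` input is derived inline from c312-3's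
  `adm_thetaRegion3_sharp` through the `m`-collapse — the PUBLIC lemma of that name is c312-3's, in
  their staged `Cor312PilotIdelesCapstone`, announced 03:37:05Z; cite theirs once landed).

The inequality hypothesis is exactly where the `j²`-scaling of the Θ-pilot enters ([IUTchIV] Step
(v); R7-C11-N1: at a deep bad place the Θ-idele at label `j` carries `−(j²/2l)·ord_v(q)·log N_v`
against the `q`-idele's `−(1/2l)·ord_v(q)·log N_v`, so the strict inequality holds at every label
`j ≥ 2` once `ord_v(q) > 0`) — the WITNESS DATA is the S-lane/c312-3/c312-5 carriers' (A2's p418519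
census), deliberately NOT built here. The frames-container sibling of record is Team A's
`not_pointwise_ofFrameVolumes_of_deep` (p418519). Sources: [IUTchIII] p. 184 l. 30–34 (Step (xi-g));
[IUTchIV] p. 27 Step (v); Dupuy–Hilado §3.7, §3.9, §4.10. [claim: Mochizuki2012, status: disputed]
[cite: DupuyHilado2025, §3.7, §3.9] [cite: ScholzeStix2018, §2.2 pp. 9–10]
Deliberately NOT here: witness idele data (carriers), the lattice-level forms (they need a real
column with `KummerA` — follows the real `LatticeSituation` when it lands), any judgement on
Cor. 3.12 or its gap rows.
-/

noncomputable section

namespace Summit.ABC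

namespace IUTFork

namespace Thm311

namespace Real

open Thm311 Cor312 Cor312Vol Literature.IUT.LogVolume Literature.IUT.LogThetaLattice

variable {F : Type} [Field F] [NumberField F] (X : PilotData F) {logv : PadicLogs F}
  (hlog : LogvAnalytic logv)
  (M : Type) [Field M] [NumberField M]
  (archPk : ∀ (j : (thetaIndex X).Label) (vQ : (thetaIndex X).VQ), Set ((logShellsDH X logv).Packet j vQ))
  (archSub : ∀ (j : (thetaIndex X).Label) (v : (thetaIndex X).V),
    Set ((logShellsDH X logv).Packet j ((thetaIndex X).over v)))
  (Ψ : ℤ → ∀ v : (thetaIndex X).V, v ∈ (thetaIndex X).Vbad → Set ((logShellsDH X logv).StarPacket v))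
  (act : ℤ → ∀ v : (thetaIndex X).V, v ∈ (thetaIndex X).Vbad →
    (logShellsDH X logv).StarPacket v → Module.End ℚ ((logShellsDH X logv).StarPacket v))
  (Mmod : ℤ → ∀ j : (thetaIndex X).LabelStar, Set ((logShellsDH X logv).GlobalPacket j.1))
  (region : ℤ → ∀ j : (thetaIndex X).LabelStar, FinDivisor M → ∀ vQ : (thetaIndex X).VQ,
    Set ((logShellsDH X logv).Packet j.1 vQ))
  (n : ℤ) {HT : Type} {LogLink : HT → HT → Type} {IsFull : ∀ {s t : HT}, LogLink s t → Prop}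
  (lat : LGPGaussianLogThetaLattice LogLink IsFull)
  {Frd : Type} {IsoF : Frd → Frd → Type} {Ob : Frd → Type} {realify : Frd → Frd} {Strip : Type}
  {IsoS : Strip → Strip → Type} {Mv : ∀ v : (thetaIndex X).V, v ∈ (thetaIndex X).Vbad → Type}
  [∀ v h, Monoid (Mv v h)]
  (sig : GlobalLGPFrobenioidSignature (thetaIndex X).lstar (thetaIndex X).V (· ∈ (thetaIndex X).Vbad)
    Frd IsoF Ob realify Strip IsoS Mv)
  (split : SplittingMonoids Mv) {ObΔ : Type} {N : ∀ v : (thetaIndex X).V, v ∈ (thetaIndex X).Vbad → Type}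
  [∀ v h, Monoid (N v h)] (qData : QPilotData ObΔ N)
  (tq : ∀ (pp : Nat.Primes) (x : (thetaIndex X).Fibre (.inr pp)),
    haveI : Fact (pp : ℕ).Prime := ⟨pp.2⟩; kOf X pp.1 x)
  (t : ∀ (pp : Nat.Primes) (_ : Fin X.lstar) (x : (thetaIndex X).Fibre (.inr pp)),
    haveI : Fact (pp : ℕ).Prime := ⟨pp.2⟩; kOf X pp.1 x)
  (htq0 : ∀ pp x, tq pp x ≠ 0)
  (htq1 : ∀ (pp : Nat.Primes) (x : (thetaIndex X).Fibre (.inr pp)),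
    haveI : Fact (pp : ℕ).Prime := ⟨pp.2⟩; placeOf X pp.1 x ∉ X.S → ‖tq pp x‖ = 1)

/-- At the sharp setting the Kummer image at EVERY lattice position `m` is the (Ind3)-enlarged region
(the boxes are `m`-constant — the sharp reading of the collapse). [folklore] -/
theorem thetaRegion_settingDHVolSharp (m : ℤ) (j : (thetaIndex X).Label) (vQ : (thetaIndex X).VQ) :
    (settingDHVolSharp X hlog M archPk archSub Ψ act Mmod region n lat sig split qData tq t htq0
      htq1).thetaRegion m j vQ =
    (settingDHVolSharp X hlog M archPk archSub Ψ act Mmod region n lat sig split qData tq t htq0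
      htq1).thetaRegion3 j vQ := by
  show (settingDHVolSharp X hlog M archPk archSub Ψ act Mmod region n lat sig split qData tq t htq0
      htq1).thetaRegion m j vQ =
    ⋃ m' : ℤ, (settingDHVolSharp X hlog M archPk archSub Ψ act Mmod region n lat sig split qData tq t
      htq0 htq1).thetaRegion m' j vQ
  exact (Set.iUnion_const _).symm

/-- **The log-volume of EVERY single Kummer image at a prime, at the sharp setting**:
`Σ_{v⃗} w·log‖t_{Θ,i+1,v_{i+1}}‖` — `m`-independent. [cite: DupuyHilado2025, §3.7, §3.9] -/
theorem logvol_thetaRegion_settingDHVolSharp_inr (ht0 : ∀ pp i x, t pp i x ≠ 0) (m : ℤ)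
    (i : Fin (thetaIndex X).lstar) (pp : Nat.Primes) :
    ((situationDHVol X hlog M archPk archSub Ψ act Mmod region).D n).logvol (Setting.labelSucc i)
      (.inr pp)
      ((settingDHVolSharp X hlog M archPk archSub Ψ act Mmod region n lat sig split qData tq t htq0
        htq1).thetaRegion m (Setting.labelSucc i) (.inr pp)) =
      haveI : Fact (pp : ℕ).Prime := ⟨pp.2⟩
      ∑ e : (presAt X hlog pp).toLocalPieces.E (Setting.labelSucc i),
        weightDH X (Setting.labelSucc i) * Real.log ‖t pp i (e (Fin.last _))‖ := by
  rw [thetaRegion_settingDHVolSharp]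
  exact logvol_thetaRegion3_sharp_inr X hlog M archPk archSub Ψ act Mmod region n lat sig split qData
    (fun _ => qCentreDH X hlog tq) (qCentreDH_ne_zero X hlog tq htq0)
    (finite_support_logvol_qRegion X hlog M archPk archSub Ψ act Mmod region n tq htq0 htq1) t ht0
    i pp

/-- **Layer 1's B-INPUT FAILS at the sharp real setting once ONE idele-norm inequality holds**: if
at one label `i+1` and one prime `p` the Θ-idele log-norm sum is strictly below the `q`-idele
log-norm sum, then `VolumeTransport` fails at `settingDHVolSharp` — the per-packet `≤`-form of the
(xi-g) comparison cannot hold there. The inequality is exactly where the `j²`-scaling enters; its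
witness data is instance-carrier material, not built here. [claim: Mochizuki2012, status: disputed] -/
theorem not_volumeTransport_settingDHVolSharp_of_lt (ht0 : ∀ pp i x, t pp i x ≠ 0)
    (i : Fin (thetaIndex X).lstar) (pp : Nat.Primes)
    (hlt : (haveI : Fact (pp : ℕ).Prime := ⟨pp.2⟩
      ∑ e : (presAt X hlog pp).toLocalPieces.E (Setting.labelSucc i),
        weightDH X (Setting.labelSucc i) * Real.log ‖t pp i (e (Fin.last _))‖) <
      haveI : Fact (pp : ℕ).Prime := ⟨pp.2⟩
      ∑ e : (presAt X hlog pp).toLocalPieces.E (Setting.labelSucc i),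
        weightDH X (Setting.labelSucc i) * Real.log ‖tq pp (e (Fin.last _))‖) :
    ¬ VolumeTransport
      (settingDHVolSharp X hlog M archPk archSub Ψ act Mmod region n lat sig split qData tq t htq0
        htq1) := by
  refine not_volumeTransport_of_packet_lt _ i (.inr pp) fun m => ?_
  show ((situationDHVol X hlog M archPk archSub Ψ act Mmod region).D n).logvol
      (Setting.labelSucc i) (.inr pp)
      ((settingDHVolSharp X hlog M archPk archSub Ψ act Mmod region n lat sig split qData tq t htq0
        htq1).thetaRegion m (Setting.labelSucc i) (.inr pp)) <
    (settingDHVolSharp X hlog M archPk archSub Ψ act Mmod region n lat sig split qData tq t htq0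
      htq1).qLocal (Setting.labelSucc i) (.inr pp)
  rw [logvol_thetaRegion_settingDHVolSharp_inr X hlog M archPk archSub Ψ act Mmod region n lat sig
    split qData tq t htq0 htq1 ht0 m i pp]
  have hq : (settingDHVolSharp X hlog M archPk archSub Ψ act Mmod region n lat sig split qData tq t
      htq0 htq1).qLocal (Setting.labelSucc i) (.inr pp) =
      haveI : Fact (pp : ℕ).Prime := ⟨pp.2⟩
      ∑ e : (presAt X hlog pp).toLocalPieces.E (Setting.labelSucc i),
        weightDH X (Setting.labelSucc i) * Real.log ‖tq pp (e (Fin.last _))‖ :=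
    logvol_qRegion_inr X hlog M archPk archSub Ψ act Mmod region n tq htq0 (Setting.labelSucc i) pp
  rw [hq]
  exact hlt

/-- The uniform forms fail as well. [folklore] -/
theorem not_volumeTransportAt_settingDHVolSharp_of_lt (ht0 : ∀ pp i x, t pp i x ≠ 0)
    (i : Fin (thetaIndex X).lstar) (pp : Nat.Primes)
    (hlt : (haveI : Fact (pp : ℕ).Prime := ⟨pp.2⟩
      ∑ e : (presAt X hlog pp).toLocalPieces.E (Setting.labelSucc i),
        weightDH X (Setting.labelSucc i) * Real.log ‖t pp i (e (Fin.last _))‖) <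
      haveI : Fact (pp : ℕ).Prime := ⟨pp.2⟩
      ∑ e : (presAt X hlog pp).toLocalPieces.E (Setting.labelSucc i),
        weightDH X (Setting.labelSucc i) * Real.log ‖tq pp (e (Fin.last _))‖) (m₀ : ℤ) :
    ¬ VolumeTransportAt
      (settingDHVolSharp X hlog M archPk archSub Ψ act Mmod region n lat sig split qData tq t htq0
        htq1) m₀ :=
  fun hat =>
    not_volumeTransport_settingDHVolSharp_of_lt X hlog M archPk archSub Ψ act Mmod region n lat sig
      split qData tq t htq0 htq1 ht0 i pp hlt (volumeTransport_of_at hat)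

/-- The packet-level strict separation at `(i+1, p)`, for every lattice position, from the one
idele-norm inequality. [folklore] -/
theorem packet_lt_settingDHVolSharp_of_lt (ht0 : ∀ pp i x, t pp i x ≠ 0)
    (i : Fin (thetaIndex X).lstar) (pp : Nat.Primes)
    (hlt : (haveI : Fact (pp : ℕ).Prime := ⟨pp.2⟩
      ∑ e : (presAt X hlog pp).toLocalPieces.E (Setting.labelSucc i),
        weightDH X (Setting.labelSucc i) * Real.log ‖t pp i (e (Fin.last _))‖) <
      haveI : Fact (pp : ℕ).Prime := ⟨pp.2⟩
      ∑ e : (presAt X hlog pp).toLocalPieces.E (Setting.labelSucc i),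
        weightDH X (Setting.labelSucc i) * Real.log ‖tq pp (e (Fin.last _))‖) (m : ℤ) :
    ((situationDHVol X hlog M archPk archSub Ψ act Mmod region).D n).logvol (Setting.labelSucc i)
      (.inr pp)
      ((settingDHVolSharp X hlog M archPk archSub Ψ act Mmod region n lat sig split qData tq t htq0
        htq1).thetaRegion m (Setting.labelSucc i) (.inr pp)) <
    (settingDHVolSharp X hlog M archPk archSub Ψ act Mmod region n lat sig split qData tq t htq0
      htq1).qLocal (Setting.labelSucc i) (.inr pp) := by
  rw [logvol_thetaRegion_settingDHVolSharp_inr X hlog M archPk archSub Ψ act Mmod region n lat sig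
    split qData tq t htq0 htq1 ht0 m i pp]
  have hq : (settingDHVolSharp X hlog M archPk archSub Ψ act Mmod region n lat sig split qData tq t
      htq0 htq1).qLocal (Setting.labelSucc i) (.inr pp) =
      haveI : Fact (pp : ℕ).Prime := ⟨pp.2⟩
      ∑ e : (presAt X hlog pp).toLocalPieces.E (Setting.labelSucc i),
        weightDH X (Setting.labelSucc i) * Real.log ‖tq pp (e (Fin.last _))‖ :=
    logvol_qRegion_inr X hlog M archPk archSub Ψ act Mmod region n tq htq0 (Setting.labelSucc i) pp
  rw [hq]
  exact hlt

/-- **The layer-2 `≤`-form the GAP row nominates FAILS at the sharp real setting**, for ANY column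
whose Kummer isomorphisms satisfy the typed Thm. 3.11 (ii) (a) against the real line data (the
abstract-column binder shape of `Cor312TeamAHonestCensusRealDH`), once the one idele-norm inequality
holds. [claim: Mochizuki2012, status: disputed] -/
theorem not_qFrobComparison_settingDHVolSharp_of_lt (C : Column (logShellsDH X logv))
    (hKumA : C.KummerA ((situationDHVol X hlog M archPk archSub Ψ act Mmod region).D n))
    (ht0 : ∀ pp i x, t pp i x ≠ 0) (i : Fin (thetaIndex X).lstar) (pp : Nat.Primes)
    (hlt : (haveI : Fact (pp : ℕ).Prime := ⟨pp.2⟩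
      ∑ e : (presAt X hlog pp).toLocalPieces.E (Setting.labelSucc i),
        weightDH X (Setting.labelSucc i) * Real.log ‖t pp i (e (Fin.last _))‖) <
      haveI : Fact (pp : ℕ).Prime := ⟨pp.2⟩
      ∑ e : (presAt X hlog pp).toLocalPieces.E (Setting.labelSucc i),
        weightDH X (Setting.labelSucc i) * Real.log ‖tq pp (e (Fin.last _))‖) :
    ¬ Cor312Vol.QFrobComparison
      (S' := { toSituation := situationDHVol X hlog M archPk archSub Ψ act Mmod region,
               col := fun _ => C })
      (settingDHVolSharp X hlog M archPk archSub Ψ act Mmod region n lat sig split qData tq t htq0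
        htq1) := by
  have hadm : Cor312Vol.ThetaRegionsAdm
      (settingDHVolSharp X hlog M archPk archSub Ψ act Mmod region n lat sig split qData tq t htq0
        htq1) := by
    intro m' i' vQ'
    show ((situationDHVol X hlog M archPk archSub Ψ act Mmod region).D n).Adm
        (Setting.labelSucc i') vQ'
        ((settingDHVolSharp X hlog M archPk archSub Ψ act Mmod region n lat sig split qData tq t
          htq0 htq1).thetaRegion m' (Setting.labelSucc i') vQ')
    rw [thetaRegion_settingDHVolSharp]
    exact adm_thetaRegion3_sharp X hlog M archPk archSub Ψ act Mmod region n lat sig split qData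
      (fun _ => qCentreDH X hlog tq) (qCentreDH_ne_zero X hlog tq htq0)
      (finite_support_logvol_qRegion X hlog M archPk archSub Ψ act Mmod region n tq htq0 htq1) t ht0
      (Setting.labelSucc i') vQ'
  exact Cor312Vol.not_qFrobComparison_of_packet_lt _ hKumA hadm i (.inr pp)
    (packet_lt_settingDHVolSharp_of_lt X hlog M archPk archSub Ψ act Mmod region n lat sig split
      qData tq t htq0 htq1 ht0 i pp hlt)

/-- **The printed uniform equality form FAILS at every lattice position** under the same binders —
the second decl the GAP row nominates. [claim: Mochizuki2012, status: disputed] -/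
theorem not_qFrobEqualityAt_settingDHVolSharp_of_lt (C : Column (logShellsDH X logv))
    (hKumA : C.KummerA ((situationDHVol X hlog M archPk archSub Ψ act Mmod region).D n))
    (ht0 : ∀ pp i x, t pp i x ≠ 0) (i : Fin (thetaIndex X).lstar) (pp : Nat.Primes)
    (hlt : (haveI : Fact (pp : ℕ).Prime := ⟨pp.2⟩
      ∑ e : (presAt X hlog pp).toLocalPieces.E (Setting.labelSucc i),
        weightDH X (Setting.labelSucc i) * Real.log ‖t pp i (e (Fin.last _))‖) <
      haveI : Fact (pp : ℕ).Prime := ⟨pp.2⟩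
      ∑ e : (presAt X hlog pp).toLocalPieces.E (Setting.labelSucc i),
        weightDH X (Setting.labelSucc i) * Real.log ‖tq pp (e (Fin.last _))‖) (m : ℤ) :
    ¬ Cor312Vol.QFrobEqualityAt
      (S' := { toSituation := situationDHVol X hlog M archPk archSub Ψ act Mmod region,
               col := fun _ => C })
      (settingDHVolSharp X hlog M archPk archSub Ψ act Mmod region n lat sig split qData tq t htq0
        htq1) m := by
  have hadm : Cor312Vol.ThetaRegionsAdm
      (settingDHVolSharp X hlog M archPk archSub Ψ act Mmod region n lat sig split qData tq t htq0
        htq1) := by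
    intro m' i' vQ'
    show ((situationDHVol X hlog M archPk archSub Ψ act Mmod region).D n).Adm
        (Setting.labelSucc i') vQ'
        ((settingDHVolSharp X hlog M archPk archSub Ψ act Mmod region n lat sig split qData tq t
          htq0 htq1).thetaRegion m' (Setting.labelSucc i') vQ')
    rw [thetaRegion_settingDHVolSharp]
    exact adm_thetaRegion3_sharp X hlog M archPk archSub Ψ act Mmod region n lat sig split qData
      (fun _ => qCentreDH X hlog tq) (qCentreDH_ne_zero X hlog tq htq0)
      (finite_support_logvol_qRegion X hlog M archPk archSub Ψ act Mmod region n tq htq0 htq1) t ht0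
      (Setting.labelSucc i') vQ'
  exact Cor312Vol.not_qFrobEqualityAt_of_packet_lt _ hKumA hadm i (.inr pp)
    (packet_lt_settingDHVolSharp_of_lt X hlog M archPk archSub Ψ act Mmod region n lat sig split
      qData tq t htq0 htq1 ht0 i pp hlt) m

end Real

end Thm311

end IUTFork

end Summit.ABC

end
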